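import Summits.BirchSwinnertonDyer.BirchSwinnertonDyer.Theorems.KimAtThreeShallowEqDeepOffStratumOfDefinedKato
import Summits.BirchSwinnertonDyer.BirchSwinnertonDyer.Theorems.KimAtThreeShallowEqDeepSplitGlue

/-!
# Crux 19599 `ShallowEqDeepOffKatoStratum` and crux 19077 `ShallowEqDeepAtTorsionFree` from the route's REGISTERED items BY NAME

Seat bsd-addord-w2-c4 (gen 10, OWNER of 19599), route W2 `KimAtThreeKolyvagin`.  The planner registered the three
support items of this seat's gen-10 reading as route decls (rev 15): `DefinedKatoUnitNonAdditiveThree` (item 20396,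
(C1ₑₓ¹ᵘ)[non-additive `t = 0` rows]), `FineKatoTauAnomalousThree` (item 20397, (C1_τ)[good anomalous `t = 0` rows]) and
`FineKatoTwoExpDefectThree` (item 20398, (C1₂)[additive-defect rows]).  This file is the BY-NAME GLUE: its hypotheses
are ROUTE DECLS and nothing else, its conclusions the cruxes BY NAME, its proofs one application each of the landed
assembly `KimAtThreeShallowEqDeepOffStratumOfDefinedKato.shallowEqDeepOffKatoStratum_of_leaves_of_definedKatoUnit`
(p510665; the registered texts are `Iff.rfl`-equal to its displayed hypotheses, which is what the kernel checks here)
and of the glue item 19600 `KimAtThreeShallowEqDeepSplitGlue.shallowEqDeepOfParts_proof`.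

* `shallowEqDeepOffKatoStratum_of_routeItems` — 19599 ⟸ `SakamotoKolyvaginThree ∧ RankEqAnalyticRankLeOne ∧
  PoitouTateSelmerDuality ∧ 20396 ∧ 20397 ∧ 20398`;
* `shallowEqDeepAtTorsionFree_of_routeItems` — 19077 ⟸ the same ∧ `CarayolLevelEqConductor ∧ KatoKuriharaPortThreeShared`
  (crux 19560), WITHOUT crux 19561 `StubAtEmptyLevelThree` (gen 4's stub-free glue);
* `shallowEqDeepAtTorsionFree_of_sharedParts_of_routeItems` — 19077 ⟸ alias 19598 `DeepUpperSplitSharedParts ∧ 20396 ∧ 20397 ∧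
  20398` (the planner's 19600 decomposition).

HONEST FRAMING: END THEOREMS WITH ROUTE-ITEM HYPOTHESES; every hypothesis is an OPEN item or a published leaf taken by
name; nothing is closed or booked by this file; 19599 / 19077 close only when items 20396–20398 (and, for 19077, 19560)
are discharged.  BSD is not proved by any of this.
References: [Kim2025RefinedTNC] Thm 1.1–1.2; [Kim2022StructureSelmer] Thm. 1.9 (6), Thm. 3.13; [Sakamoto2024] Thm. 4.4;
[MazurRubin2004] Thm. 4.4.1, 5.2.12; [Kato2004Asterisque] Thm. 9.7, Ex. 13.3; memo HOME/w2c4/W2C4-MULT-TWOEXP-g10.md.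
-/

set_option linter.dupNamespace false

namespace Summit.BirchSwinnertonDyer.BirchSwinnertonDyer.Theorems.KimAtThreeShallowEqDeepOffStratumOfRouteItems

open Summit.BirchSwinnertonDyer.BirchSwinnertonDyer.Theses.KimAtThreeKolyvagin

/-- **Crux 19599 `ShallowEqDeepOffKatoStratum` BY NAME ⟸ the three published leaves BY NAME ∧ the registered support items
20396 `DefinedKatoUnitNonAdditiveThree` ∧ 20397 `FineKatoTauAnomalousThree` ∧ 20398 `FineKatoTwoExpDefectThree` BY NAME.**
CONDITIONAL on those items; nothing booked. [cite: Kim2025RefinedTNC, Thm 1.1, Thm 1.2]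
[cite: Kim2022StructureSelmer, Thm. 1.9 (6), Thm. 3.13] [cite: Sakamoto2024, Thm. 4.4 (p. 926)]
[cite: MazurRubin2004, Thm. 4.4.1 and Thm. 5.2.12] -/
theorem shallowEqDeepOffKatoStratum_of_routeItems
    (hSak : SakamotoKolyvaginThree) (hGZK : RankEqAnalyticRankLeOne) (hPT : PoitouTateSelmerDuality)
    (h₁ : DefinedKatoUnitNonAdditiveThree) (h₂ : FineKatoTauAnomalousThree) (h₃ : FineKatoTwoExpDefectThree) :
    ShallowEqDeepOffKatoStratum :=
  KimAtThreeShallowEqDeepOffStratumOfDefinedKato.shallowEqDeepOffKatoStratum_of_leaves_of_definedKatoUnit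
    hSak.1 hSak.2 hGZK hPT h₁ h₂ h₃

/-- **Crux 19077 `ShallowEqDeepAtTorsionFree` BY NAME ⟸ the four published leaves ∧ crux 19560 `KatoKuriharaPortThreeShared` ∧
items 20396 ∧ 20397 ∧ 20398, all BY NAME** — no `StubAtEmptyLevelThree` (crux 19561) needed.  CONDITIONAL; nothing booked.
[cite: Kim2025RefinedTNC, Thm 1.2] [cite: Sakamoto2024, Thm. 4.4 (p. 926)] [cite: MazurRubin2004, Thm. 5.2.12]
[cite: Kato2004Asterisque, Thm. 9.7 (p. 189), Ex. 13.3] [cite: Carayol1986] -/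
theorem shallowEqDeepAtTorsionFree_of_routeItems
    (hSak : SakamotoKolyvaginThree) (hGZK : RankEqAnalyticRankLeOne) (hPT : PoitouTateSelmerDuality)
    (hlev : CarayolLevelEqConductor) (hPort : KatoKuriharaPortThreeShared)
    (h₁ : DefinedKatoUnitNonAdditiveThree) (h₂ : FineKatoTauAnomalousThree) (h₃ : FineKatoTwoExpDefectThree) :
    ShallowEqDeepAtTorsionFree :=
  KimAtThreeShallowEqDeepOffStratumOfDefinedKato.shallowEqDeepAtTorsionFree_of_leaves_of_definedKatoUnit
    hSak hGZK hPT hlev hPort h₁ h₂ h₃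

/-- **Crux 19077 BY NAME ⟸ alias 19598 `DeepUpperSplitSharedParts` ∧ items 20396 ∧ 20397 ∧ 20398 BY NAME** — the planner's
19600 decomposition `ShallowEqDeepOfParts` fed with §1.  CONDITIONAL; nothing booked. [cite: Kim2025RefinedTNC, Thm 1.2]
[cite: Sakamoto2024, Thm. 4.4 (p. 926)] [cite: MazurRubin2004, Thm. 4.4.1 and Thm. 5.2.12] [cite: Carayol1986] -/
theorem shallowEqDeepAtTorsionFree_of_sharedParts_of_routeItems
    (hU : DeepUpperSplitSharedParts)
    (h₁ : DefinedKatoUnitNonAdditiveThree) (h₂ : FineKatoTauAnomalousThree) (h₃ : FineKatoTwoExpDefectThree) :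
    ShallowEqDeepAtTorsionFree :=
  KimAtThreeShallowEqDeepSplitGlue.shallowEqDeepOfParts_proof hU
    (shallowEqDeepOffKatoStratum_of_routeItems hU.1 hU.2.1 hU.2.2.1 h₁ h₂ h₃)

end Summit.BirchSwinnertonDyer.BirchSwinnertonDyer.Theorems.KimAtThreeShallowEqDeepOffStratumOfRouteItems
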